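import Literature.AlgebraicGeometry.Resolution.DefectlessComposite
import Mathlib.FieldTheory.Relrank
import HarnessLib

/-!
# `e` and `f` inside an ambient valued field: value subgroups and residue subfields of subfields

Topic: `Literature/AlgebraicGeometry/Resolution` (valued function fields). PROVED bookkeeping for the
finite-level proof of Kuhlmann 2010, Cor. 2.25 (`Kuhlmann2010DefectlessDescent`): when all the
fields of an argument sit inside ONE valued field `(Ω, V)` (as in §2.4 of the source: "Let
`(Ω|K,v)` be an extension of valued fields and `F|K` and `L|K` two subextensions of `Ω|K` …
`vF ∩ vL`, `F̄.L̄` …"), the invariants `e(V ∩ B / A) = (vB : vA)` and `f(V ∩ B / A) = [Bv : Av]` of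
`ValuationDefect.lean` (defined through the valuation ring `V ∩ B` of `B` and ITS value group and
residue field) are the relative index of the value subgroups `vA ≤ vB ≤ vΩ`
(`valueSubgroup A V`, `valueSubgroup B V`) and the relative degree of the residue subfields
`Av ≤ Bv ≤ Ωv` (`residueSubfield A V`, `residueSubfield B V`). This turns the comparison of `e`
and `f` across non-nested fields (Lemma 2.19, Prop. 2.24 of the source) into lattice
computations in `vΩ` and `Ωv`.

## Content (everything PROVED, [folklore])

* `ramificationIndex_comap_eq_relIndex` — `e(V ∩ B / A) = (vB : vA)` computed in `|Ω^×|_V`.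
* `inertiaDegree_comap_eq_relfinrank` — `f(V ∩ B / A) = [Bv : Av]` computed in `κ(V)`
  (Mathlib's `Subfield.relfinrank`).
* `valueSubgroup_le_of_range_subset`, `residueSubfield_le_of_range_subset`,
  `valueSubgroup_eq_of_range_eq`, `residueSubfield_eq_of_range_eq` — monotonicity in the field.
* `relIndex_le_relIndex_of_inf_le` — `(G : H) ≤ (G' : H')` for `H ≤ H'`, `G ≤ G'`, `H' ∩ G ≤ H`
  (the value-group half of Prop. 2.24: "`(v(L.F) : vF) ≥ (vL + vF : vF) = (vL : vK)`" when
  `vL ∩ vF = vK`).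
* `relfinrank_sup_le_relfinrank` — `[A'·B : A'] ≤ [B : A]` for subfields `A ≤ A'`, `A ≤ B`
  (base change can only lower the degree; the residue-field half).
* `inf_valueSubgroup_le_of_isAlgebraic` — if `vF/vK` is torsion free (inside `vΩ`) and `N/K` is
  algebraic then `vF ∩ vN ⊆ vK` (values of algebraic elements are torsion modulo `vK`).

## Sources

* F.-V. Kuhlmann, Trans. AMS 362 (2010) = arXiv:1003.5678, §2.4, Lemma 2.19 and Prop. 2.24
  (p. 8). [folklore]
-/

noncomputable section

open IsLocalRing

namespace Literature.AlgebraicGeometry.Resolution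

universe u

variable {Ω : Type u} [Field Ω] (V : ValuationSubring Ω)

section Bridge

variable (A : Type u) [Field A] [Algebra A Ω] (B : IntermediateField A Ω)

/-- **`e(V ∩ B / A) = (vB : vA)` inside `|Ω^×|`**: for `A → B ⊆ Ω` and the valuation ring
`V ∩ B` of `B`, the ramification index over `A` is the relative index of the value subgroups of
`A` and `B` in the value group of `V`. [folklore] -/
theorem ramificationIndex_comap_eq_relIndex :
    ramificationIndex A (V.comap (algebraMap B Ω)) =
      (valueSubgroup A V).relIndex (valueSubgroup B V) := by
  set W := V.comap (algebraMap B Ω) with hW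
  have hinj := unitsValueGroupHom_injective B V
  have hmap : (valueSubgroup A W).map (unitsValueGroupHom B V) = valueSubgroup A V :=
    map_valueSubgroup A B V
  have hcomap : valueSubgroup A W = (valueSubgroup A V).comap (unitsValueGroupHom B V) := by
    rw [← hmap, Subgroup.comap_map_eq_self_of_injective hinj]
  unfold ramificationIndex
  rw [hcomap, ← Subgroup.relIndex_top_right, Subgroup.relIndex_comap, ← MonoidHom.range_eq_map,
    range_unitsValueGroupHom]

/-- **`f(V ∩ B / A) = [Bv : Av]` inside `κ(V)`**: the inertia degree over `A` of the valuation
ring `V ∩ B` of `B` is the relative degree of the residue subfields of `A` and `B` in the residue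
field of `V`. [folklore] -/
theorem inertiaDegree_comap_eq_relfinrank :
    inertiaDegree A (V.comap (algebraMap B Ω)) =
      (residueSubfield A V).relfinrank (residueSubfield B V) := by
  have hle : residueSubfield A V ≤ residueSubfield B V := residueSubfield_le_residueSubfield A B V
  rw [Subfield.relfinrank_eq_finrank_of_le hle]
  unfold inertiaDegree
  exact finrank_eq_finrank_of_map_eq (residueFieldHom B V) (residueSubfield A _)
    (map_residueSubfield A B V) (fieldRange_residueFieldHom B V) hle

end Bridge

section Mono

variable {A₁ A₂ : Type u} [Field A₁] [Field A₂] [Algebra A₁ Ω] [Algebra A₂ Ω]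

/-- `vA₁ ⊆ vA₂` if `A₁ ⊆ A₂` inside `Ω`. [folklore] -/
theorem valueSubgroup_le_of_range_subset
    (h : Set.range (algebraMap A₁ Ω) ⊆ Set.range (algebraMap A₂ Ω)) :
    valueSubgroup A₁ V ≤ valueSubgroup A₂ V := by
  intro γ hγ
  obtain ⟨c, hc0, hγ⟩ := (mem_valueSubgroup_iff A₁ V γ).mp hγ
  obtain ⟨d, hd⟩ := h ⟨c, rfl⟩
  refine (mem_valueSubgroup_iff A₂ V γ).mpr ⟨d, ?_, by rw [hd]; exact hγ⟩
  rintro rfl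
  rw [map_zero] at hd
  exact hc0 ((map_eq_zero _).mp hd.symm)

/-- `A₁v ⊆ A₂v` if `A₁ ⊆ A₂` inside `Ω`. [folklore] -/
theorem residueSubfield_le_of_range_subset
    (h : Set.range (algebraMap A₁ Ω) ⊆ Set.range (algebraMap A₂ Ω)) :
    residueSubfield A₁ V ≤ residueSubfield A₂ V := by
  intro r hr
  obtain ⟨c, hc, rfl⟩ := (mem_residueSubfield_iff A₁ V r).mp hr
  obtain ⟨d, hd⟩ := h ⟨c, rfl⟩
  refine (mem_residueSubfield_iff A₂ V _).mpr ⟨d, by rw [hd]; exact hc, ?_⟩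
  congr 1
  exact Subtype.ext hd

/-- `vA₁ = vA₂` if `A₁ = A₂` inside `Ω`. [folklore] -/
theorem valueSubgroup_eq_of_range_eq
    (h : Set.range (algebraMap A₁ Ω) = Set.range (algebraMap A₂ Ω)) :
    valueSubgroup A₁ V = valueSubgroup A₂ V :=
  le_antisymm (valueSubgroup_le_of_range_subset V h.le) (valueSubgroup_le_of_range_subset V h.ge)

/-- `A₁v = A₂v` if `A₁ = A₂` inside `Ω`. [folklore] -/
theorem residueSubfield_eq_of_range_eq
    (h : Set.range (algebraMap A₁ Ω) = Set.range (algebraMap A₂ Ω)) :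
    residueSubfield A₁ V = residueSubfield A₂ V :=
  le_antisymm (residueSubfield_le_of_range_subset V h.le)
    (residueSubfield_le_of_range_subset V h.ge)

end Mono

section Lattice

/-- **Relative indices grow under a compatible enlargement**: for subgroups `H ≤ H'`, `G ≤ G'`
with `H' ∩ G ⊆ H` (so `G/H → G'/H'` is injective) and `(G' : H')` finite,
`(G : H) ≤ (G' : H')`. This is the group-theoretic content of "`(v(L.F) : vF) ≥ (vL : vK)`" in
Kuhlmann 2010, Prop. 2.24 (with `H = vK`, `G = vL`, `H' = vF`, `G' = v(L.F)`, `vL ∩ vF = vK`).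
[folklore] -/
theorem relIndex_le_relIndex_of_inf_le {Γ : Type*} [CommGroup Γ] {H G H' G' : Subgroup Γ}
    (hH : H ≤ H') (hG : G ≤ G') (hHG : H ≤ G) (hinf : H' ⊓ G ≤ H) (hfin : H'.relIndex G' ≠ 0) :
    H.relIndex G ≤ H'.relIndex G' := by
  have heq : H = H' ⊓ G := le_antisymm (le_inf hH hHG) hinf
  rw [heq, Subgroup.inf_relIndex_right]
  exact Subgroup.relIndex_le_of_le_right hG hfin

/-- **Base change lowers the degree**: for subfields `A ≤ A'` and `A ≤ B` of a field `Φ` with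
`[B : A]` finite, `[A'·B : A'] ≤ [B : A]` (`A'·B = A' ⊔ B`). PROVED from Mathlib's
`IntermediateField.adjoin_rank_le_of_isAlgebraic`. [folklore] -/
theorem relfinrank_sup_le_relfinrank {Φ : Type u} [Field Φ] {A A' B : Subfield Φ} (hA : A ≤ A')
    (hB : A ≤ B) (hfin : A.relfinrank B ≠ 0) :
    A'.relfinrank (A' ⊔ B) ≤ A.relfinrank B := by
  letI : Algebra A A' := (Subfield.inclusion hA).toAlgebra
  haveI : IsScalarTower A A' Φ := IsScalarTower.of_algebraMap_eq fun _ => rfl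
  set B' : IntermediateField A Φ := Subfield.extendScalars hB with hB'
  haveI : FiniteDimensional A B' := by
    rw [Subfield.relfinrank_eq_finrank_of_le hB] at hfin
    exact Module.finite_of_finrank_pos (Nat.pos_of_ne_zero hfin)
  haveI : Algebra.IsAlgebraic A B' := Algebra.IsAlgebraic.of_finite A B'
  have h := IntermediateField.adjoin_rank_le_of_isAlgebraic_right A' B'
  -- `A'(B) = A' ⊔ B` as intermediate fields over `A'`
  have hadj : IntermediateField.adjoin A' (B' : Set Φ) = Subfield.extendScalars (le_sup_left : A' ≤ A' ⊔ B) := by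
    apply IntermediateField.toSubfield_injective
    rw [IntermediateField.adjoin_toSubfield, Subfield.extendScalars_toSubfield, Subfield.closure_union]
    have h1 : Subfield.closure (Set.range (algebraMap A' Φ)) = A' := by
      have : Set.range (algebraMap A' Φ) = (A' : Set Φ) := by
        ext x; exact ⟨fun ⟨y, hy⟩ => hy ▸ y.2, fun hx => ⟨⟨x, hx⟩, rfl⟩⟩
      rw [this, Subfield.closure_eq]
    have h2 : Subfield.closure (B' : Set Φ) = B := by
      have : (B' : Set Φ) = (B : Set Φ) := rfl
      rw [this]
      exact Subfield.closure_eq B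
    rw [h1, h2]
  rw [hadj] at h
  rw [Subfield.relfinrank_eq_finrank_of_le le_sup_left, Subfield.relfinrank_eq_finrank_of_le hB]
  have hfin' : Module.rank A B' < Cardinal.aleph0 := Module.rank_lt_aleph0 A B'
  exact Cardinal.toNat_le_toNat h hfin'

end Lattice

section Torsion

variable {K F N : Type u} [Field K] [Field F] [Field N] [Algebra K Ω] [Algebra F Ω] [Algebra N Ω]

/-- **`vF ∩ vN ⊆ vK`** when `vF/vK` is torsion free and `N/K` is algebraic (inside `Ω`): the value
of a non-zero element algebraic over `K` is torsion modulo `vK`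
(`exists_valuation_pow_eq_of_isAlgebraic`), so a value of `F` which is also a value of `N` is
torsion modulo `vK`, hence in `vK`. This is "condition 1)" of Kuhlmann 2010, Lemma 2.19 for the
pair `(F, K̃)`: `vF ∩ vK̃ = vK` iff `vF/vK` is torsion free (Lemma 2.20). [folklore] -/
theorem inf_valueSubgroup_le_of_isAlgebraic
    (hTF : ∀ γ : (V.ValueGroup)ˣ, γ ∈ valueSubgroup F V → ∀ n : ℕ, 0 < n →
      γ ^ n ∈ valueSubgroup K V → γ ∈ valueSubgroup K V)
    (halg : ∀ x : N, IsAlgebraic (algebraMap K Ω).fieldRange (algebraMap N Ω x)) :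
    valueSubgroup F V ⊓ valueSubgroup N V ≤ valueSubgroup K V := by
  rintro γ ⟨hγF, hγN⟩
  obtain ⟨c, hc0, hγc⟩ := (mem_valueSubgroup_iff N V γ).mp hγN
  have hc0' : algebraMap N Ω c ≠ 0 := (map_ne_zero _).mpr hc0
  obtain ⟨n, hn0, b, ⟨d, rfl⟩, hnb⟩ := exists_valuation_pow_eq_of_isAlgebraic V (halg c) hc0'
  refine hTF γ hγF n (Nat.pos_of_ne_zero hn0) ((mem_valueSubgroup_iff K V _).mpr ⟨d, ?_, ?_⟩)
  · rintro rfl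
    rw [map_zero, map_zero, map_pow, pow_eq_zero_iff hn0] at hnb
    exact hc0' ((map_eq_zero _).mp hnb)
  · rw [Units.val_pow_eq_pow_val, hγc, ← map_pow, hnb]

end Torsion

end Literature.AlgebraicGeometry.Resolution
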